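import Summits.CriticalPhenomena.PercolationContinuityZ3.Theorems.PercNearOneGluingNoHeavyLowerTailCSHPsiDefs
import Summits.CriticalPhenomena.PercolationContinuityZ3.Theorems.PercNearOneGluingNoHeavyLowerTailCSHPeelTools
import HarnessLib

/-!
# Pinned hierarchy — two small tools for the refined pre-FKG peeling

Support file (`--supports stmt-CriticalPhenomena-4575`), route task `nh-dp-fatminority` (gen 15); memo
`run/shared/lean/prim/prim-nh-dp-fatminority/CSH-PSI-MEMO.md` §3.  No definitions, no named facts, no sorries.
`PinCSH.mem_pDecoyList` (the decoys of the pinned decoy list are the listed vertices) and `PinCSH.pCovD_psiIso` (the `Ψ_iso` identity at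
the pinned label, behind Lemma AC of the peeling: `pCovD(k; T'; Ψ_iso)(o) = μ(D_k ∩ {C_k = ∅}) · μ(D_k ∩ pinEv o 𝓗 k)` for `o ≠ k`).
[cite: VandenbergHaggstromKahn2005, §2.1 (p. 10)] [cite: KozmaNitzan2024, Conj. 4 (p. 32)]
-/

noncomputable section

namespace Summit.CriticalPhenomena.PercolationContinuityZ3.Theorems

open MeasureTheory Set Literature.Probability.LatticeModels Literature.Probability.Percolation
open scoped Classical
open CSH

namespace PinCSH

variable {V : Type*}

/-- The decoys of `pDecoyList w o 𝓗 A D` are the members of `D`. [folklore] -/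
theorem mem_pDecoyList (w : Sym2 V → unitInterval) (o : V) (𝓗 : Set (Set (Sym2 V))) :
    ∀ (A : Set V) (D : List V) (dc : V × (V → ℝ)), dc ∈ pDecoyList w o 𝓗 A D → dc.1 ∈ D
  | _, [], dc, h => by simp [pDecoyList] at h
  | A, d :: D, dc, h => by
    simp only [pDecoyList, List.mem_cons] at h
    rcases h with rfl | h
    · exact List.mem_cons_self
    · exact List.mem_cons_of_mem _ (mem_pDecoyList w o 𝓗 (insert d A) D dc h)

variable {n : ℕ}

/-- **The `Ψ_iso` identity at the pinned label** (behind Lemma AC): for `o ≠ k`,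
`pCovD(k; T'; Ψ_iso)(o) = μ(D_k ∩ {C_k = ∅}) · μ(D_k ∩ pinEv o 𝓗 k)`. (transcription of the memo prim-nh-dp-fatminority CSH-PSI-MEMO.md §3) [folklore] -/
theorem pCovD_psiIso (w : Sym2 (Fin n) → unitInterval) (o : Fin n) (𝓗 : Set (Set (Sym2 (Fin n)))) (T' : Finset (Fin n))
    (k : Fin n) (hok : o ≠ k) :
    pCovD w o 𝓗 k (↑T' : Set (Fin n)) psiIso o =
      (prodBernoulli w).real ({ω : BondConfig (Fin n) | ∀ a ∈ (↑T' : Set (Fin n)), ¬ (openGraph ω).Reachable k a} ∩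
          {ω | openEdgeCluster ω k = ∅}) *
        (prodBernoulli w).real ({ω : BondConfig (Fin n) | ∀ a ∈ (↑T' : Set (Fin n)), ¬ (openGraph ω).Reachable k a} ∩
          pinEv o 𝓗 k) := by
  classical
  set μ := prodBernoulli w with hμ
  have hmeas : ∀ S : Set (BondConfig (Fin n)), MeasurableSet S := fun _ => MeasurableSet.of_discrete
  set Dk : Set (BondConfig (Fin n)) := {ω : BondConfig (Fin n) | ∀ a ∈ (↑T' : Set (Fin n)), ¬ (openGraph ω).Reachable k a} with hDk
  have h1 : ∫ ω in Dk ∩ pinEv o 𝓗 k, psiIso (openEdgeCluster ω k) ∂μ = μ.real (Dk ∩ pinEv o 𝓗 k) := by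
    rw [setIntegral_congr_fun (hmeas _) (fun ω hω => psiIso_eq_one_of_reachable hok hω.2.1), setIntegral_const, smul_eq_mul,
      mul_one]
  have h2 : ∫ ω in Dk, psiIso (openEdgeCluster ω k) ∂μ = μ.real Dk - μ.real (Dk ∩ {ω | openEdgeCluster ω k = ∅}) := by
    have hsplit := (integral_inter_add_sdiff (hmeas {ω : BondConfig (Fin n) | openEdgeCluster ω k = ∅})
      ((Integrable.of_finite (f := fun ω => psiIso (openEdgeCluster ω k)) (μ := μ)).integrableOn (s := Dk))).symm
    rw [hsplit]
    have ha : ∫ ω in Dk ∩ {ω | openEdgeCluster ω k = ∅}, psiIso (openEdgeCluster ω k) ∂μ = 0 := by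
      rw [setIntegral_congr_fun (hmeas _) (fun ω hω => by
        show psiIso (openEdgeCluster ω k) = (0 : ℝ)
        unfold psiIso; rw [if_pos (show openEdgeCluster ω k = ∅ from hω.2)])]
      simp
    have hb : ∫ ω in Dk \ {ω | openEdgeCluster ω k = ∅}, psiIso (openEdgeCluster ω k) ∂μ =
        μ.real (Dk \ {ω | openEdgeCluster ω k = ∅}) := by
      rw [setIntegral_congr_fun (hmeas _) (fun ω hω => by
        show psiIso (openEdgeCluster ω k) = (1 : ℝ)
        unfold psiIso; rw [if_neg (show ¬ (openEdgeCluster ω k = ∅) from hω.2)]), setIntegral_const, smul_eq_mul, mul_one]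
    rw [ha, hb, zero_add]
    have := measureReal_inter_add_sdiff (μ := μ) (s := Dk) (h := measure_ne_top _ _)
      (hmeas {ω : BondConfig (Fin n) | openEdgeCluster ω k = ∅})
    linarith
  unfold pCovD
  rw [if_pos rfl]
  simp only [Finset.mem_coe] at hDk ⊢
  rw [← hDk, h1, h2]
  ring

end PinCSH

end Summit.CriticalPhenomena.PercolationContinuityZ3.Theorems
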